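import Summits.AtomisticToContinuum.Crystallization.Theorems.FreeSplittingCertificatesStrictSplittingRuleP1TrussSign
import Summits.AtomisticToContinuum.Crystallization.Theorems.FreeSplittingCertificatesStrictSplittingRuleP1ReadSummable
import Summits.AtomisticToContinuum.Crystallization.Theorems.FreeSplittingCertificatesStrictSplittingRuleP1AssemblyGlue
import Summits.AtomisticToContinuum.Crystallization.Theorems.FreeSplittingCertificatesStrictSplittingRuleSummableTransfer

/-!
# `StrictSplittingRule` (stmt-AtomisticToContinuum-12560): THE FAR READOUT SHARES OF RULE v31 AS FUNCTIONS — `½β·χ²(midpoint)` off the shed set — with their side conditions (P1 interpolant object, part 75)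

Route `FreeSplittingCertificates`, crux r3 `StrictSplittingRule` (H12⋆ = `stub_coreJointCoercive`), unit b2b-freesplit-B gen 34.
VALUE = G9b interface data PINNED.  In the cell's endpoint (parts 73/74) the in-layer far shares `w p`, the vertical far shares `wv p`, the vertical
offset `sv p` and the near legs `LEG p` are hypotheses with side conditions `hw, hws, hwv, hwvs, hwfar`.  The matched readout rule of the cell
(HOME CERT §28 "RULES", `nearcert.py` matched branch / `cellval.py`): the far side takes `φ_e·χ²(s_mid(e))·½β(e)` of each readout leg `e = (q, s)`,
`χ` = the split weight centred at `y_p` evaluated at the bond MIDPOINT, `φ_e = 0` exactly on the shed set `φ0` (table `matched25c.json` 'phi0', 308 legs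
per parity, offsets relative to the ledger centre), `1` otherwise; the near side keeps the rest.  Here, for a shed set `φ` (a finset of (offset, stencil
vector) pairs — the ONLY datum left):
* `p1MidChiSq a h p q s` = `χ²` at the midpoint of the leg `(q, q+s)` seen from `y_p` (interface `(R₁,R₂) = (81/20·a, 27/5·a)`);
* **`p1FarW a h φ p (q,s)`** = `[q ≠ p][s in-layer stencil][(q−p,s) ∉ φ]·½β(b_q)(p−q)(s)·χ²_mid`, **`p1FarWv a h φ p q`** = the same for the vertical bond `(2,0,0)`;
* `p1FarLegs φ p` = the near legs: stencil legs based in the index box of part 63 around `p`, plus the shed legs;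
and the side conditions: `p1FarW_nonneg` / `p1FarWv_nonneg` (β ≥ 0 wherever χ_mid ≠ 0: the base is ≥ 1 from `y_p`, `p1Beta_nonneg_of_one_le`),
`summable_p1FarW_load` / `summable_p1FarWv` (decay of β), **`p1Far_hwfar`** (off `p1FarLegs` the far side takes the full `½β`: χ_mid = 1 beyond the box).
Assumes `3a/4 ≤ h ≤ 9a/10`, `1 ≤ 2a` (the `HcpFamilyMin` box).  NOT a proof of H12⋆, NOT summit progress.  [folklore]
-/

noncomputable section

open Set Function Metric MeasureTheory Filter Topology
open scoped BigOperators NNReal ENNReal Classical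

namespace Summit.AtomisticToContinuum.Crystallization.Theorems.StrictSplittingRuleBirth

open Literature.MathematicalPhysics.StatisticalMechanics
open Summit.AtomisticToContinuum.Crystallization.Theorems.PalmUnimodularRigidity.LayeredLawsSelectHcp

/-! ## Definitions -/

/-- The three IN-LAYER stencil directions (cell edges). [folklore] -/
def p1StencilIn : Finset (ℤ × ℤ × ℤ) := {(0, 1, 0), (0, 0, 1), (0, -1, 1)}

/-- The VERTICAL stencil bond `(2,0,0)` (site vector `2h·e₃`; routed, part 33). [folklore] -/
def p1SV : ℤ × ℤ × ℤ := (2, 0, 0)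

/-- `χ²` of the split weight (interface `(81/20·a, 27/5·a)`, centred at `y_p`) at the MIDPOINT of the leg `(q, q+s)`. [folklore] -/
def p1MidChiSq (a h : ℝ) (p q s : ℤ × ℤ × ℤ) : ℝ :=
  fpChi ((81 / 20 * a) ^ 2) ((27 / 5 * a) ^ 2) (fun k => (hcpSite a h q k + hcpSite a h (q + s) k) / 2 - hcpSite a h p k) ^ 2

/-- **THE IN-LAYER FAR SHARE** of the leg `e = (q, s)` at representative `p` for the shed set `φ`:
`[q ≠ p]·[s ∈ p1StencilIn]·[(q − p, s) ∉ φ]·½β(b_q)(p−q)(s)·χ²_mid`. [folklore] -/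
def p1FarW (a h : ℝ) (φ : Finset ((ℤ × ℤ × ℤ) × (ℤ × ℤ × ℤ))) (p : ℤ × ℤ × ℤ) (e : (ℤ × ℤ × ℤ) × (ℤ × ℤ × ℤ)) : ℝ :=
  if e.1 ≠ p ∧ e.2 ∈ p1StencilIn ∧ (e.1 - p, e.2) ∉ φ then
    1 / 2 * p1Beta a h (decide (Even e.1.1)) (p - e.1) e.2 * p1MidChiSq a h p e.1 e.2 else 0

/-- **THE VERTICAL FAR SHARE** of the bond `(q, q + (2,0,0))`: `[q ≠ p]·[(q − p, (2,0,0)) ∉ φ]·½β(b_q)(p−q)((2,0,0))·χ²_mid`. [folklore] -/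
def p1FarWv (a h : ℝ) (φ : Finset ((ℤ × ℤ × ℤ) × (ℤ × ℤ × ℤ))) (p q : ℤ × ℤ × ℤ) : ℝ :=
  if q ≠ p ∧ (q - p, p1SV) ∉ φ then 1 / 2 * p1Beta a h (decide (Even q.1)) (p - q) p1SV * p1MidChiSq a h p q p1SV else 0

/-- The index box of part 63 around `p` (every site outside it is ≥ 12a from `y_p` in some coordinate). [folklore] -/
def p1SiteBox (p : ℤ × ℤ × ℤ) : Finset (ℤ × ℤ × ℤ) :=
  Finset.Icc (p.1 - 15) (p.1 + 15) ×ˢ (Finset.Icc (p.2.1 - 20) (p.2.1 + 20) ×ˢ Finset.Icc (p.2.2 - 14) (p.2.2 + 14))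

/-- **THE NEAR LEGS**: stencil legs based in the box, plus the shed legs (translated to absolute base sites). [folklore] -/
def p1FarLegs (φ : Finset ((ℤ × ℤ × ℤ) × (ℤ × ℤ × ℤ))) (p : ℤ × ℤ × ℤ) : Finset ((ℤ × ℤ × ℤ) × (ℤ × ℤ × ℤ)) :=
  (p1SiteBox p ×ˢ p1Stencil) ∪ φ.image fun ds => (ds.1 + p, ds.2)

/-! ## Small facts -/

/-- The in-layer stencil is part of the stencil. -/
theorem p1StencilIn_subset : p1StencilIn ⊆ p1Stencil := by
  intro s hs
  simp only [p1StencilIn, Finset.mem_insert, Finset.mem_singleton] at hs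
  rcases hs with rfl | rfl | rfl <;> simp [p1Stencil]

/-- The vertical bond is a stencil vector. -/
theorem p1SV_mem : p1SV ∈ p1Stencil := by simp [p1SV, p1Stencil]

/-- The stencil = in-layer directions + the vertical bond. -/
theorem mem_p1Stencil_iff (s : ℤ × ℤ × ℤ) : s ∈ p1Stencil ↔ s ∈ p1StencilIn ∨ s = p1SV := by
  simp only [p1Stencil, p1StencilIn, p1SV, Finset.mem_insert, Finset.mem_singleton]
  tauto

/-- The vertical bond is not in-layer. -/
theorem not_mem_p1StencilIn_p1SV : p1SV ∉ p1StencilIn := by simp [p1SV, p1StencilIn]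

/-- `0 ≤ χ²_mid ≤ 1`. -/
theorem p1MidChiSq_nonneg (a h : ℝ) (p q s : ℤ × ℤ × ℤ) : 0 ≤ p1MidChiSq a h p q s := sq_nonneg _

/-- `χ²_mid ≤ 1`. -/
theorem p1MidChiSq_le_one (a h : ℝ) (p q s : ℤ × ℤ × ℤ) : p1MidChiSq a h p q s ≤ 1 := by
  unfold p1MidChiSq
  have h1 := abs_fpChi_le_one ((81 / 20 * a) ^ 2) ((27 / 5 * a) ^ 2)
    (fun k => (hcpSite a h q k + hcpSite a h (q + s) k) / 2 - hcpSite a h p k)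
  rw [abs_le] at h1
  nlinarith [h1.1, h1.2]

/-- `fpSq` of a coordinate function of a Euclidean vector is its squared norm. -/
theorem fpSq_coe_eq_norm_sq (v : EuclideanSpace ℝ (Fin 3)) : fpSq (fun k => v k) = ‖v‖ ^ 2 := by
  rw [norm_sq_eq_three]; rfl

/-- The stencil bonds have length at most `2a` (in-layer `a`, vertical `2h ≤ 2a` for `h ≤ a`). -/
theorem norm_stencil_bond_le {a h : ℝ} (ha : 0 < a) (hh : 0 < h) (hha : h ≤ a) (q : ℤ × ℤ × ℤ) {s : ℤ × ℤ × ℤ} (hs : s ∈ p1Stencil) :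
    ‖hcpSite a h (q + s) - hcpSite a h q‖ ≤ 2 * a := by
  have hs' : s ∈ ({(0, 1, 0), (0, 0, 1), (0, -1, 1), (2, 0, 0)} : Finset (ℤ × ℤ × ℤ)) := hs
  have heven := h1_stencil_even hs'
  have hv : hcpSite a h (q + s) - hcpSite a h q = hcpSite a h s := by
    rw [h1_sub_eq]
    split_ifs with hq
    · rfl
    · rw [h1_neg_of_even a h (by simpa using heven), neg_neg]
  rw [hv]
  have hn := h1_stencil_norm_sq a h hs'
  have h4 : ‖hcpSite a h s‖ ^ 2 ≤ (2 * a) ^ 2 := by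
    rw [hn]; split_ifs <;> nlinarith
  exact (pow_le_pow_iff_left₀ (norm_nonneg _) (by positivity) two_ne_zero).1 h4

/-- The midpoint vector, as a Euclidean vector: `(y_q − y_p) + ½(y_{q+s} − y_q)`. -/
theorem p1MidChiSq_eq (a h : ℝ) (p q s : ℤ × ℤ × ℤ) :
    p1MidChiSq a h p q s = fpChi ((81 / 20 * a) ^ 2) ((27 / 5 * a) ^ 2)
      (fun k => ((hcpSite a h q - hcpSite a h p) + (1 / 2 : ℝ) • (hcpSite a h (q + s) - hcpSite a h q)) k) ^ 2 := by
  unfold p1MidChiSq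
  congr 2
  funext k
  simp only [PiLp.add_apply, PiLp.sub_apply, PiLp.smul_apply, smul_eq_mul]
  ring

/-- **Beyond `32/5·a` the midpoint weight is 1.** -/
theorem p1MidChiSq_eq_one_of_far {a h : ℝ} (ha : 0 < a) (hh : 0 < h) (hha : h ≤ a) (p q : ℤ × ℤ × ℤ) {s : ℤ × ℤ × ℤ}
    (hs : s ∈ p1Stencil) (hfar : 32 / 5 * a ≤ ‖hcpSite a h q - hcpSite a h p‖) : p1MidChiSq a h p q s = 1 := by
  rw [p1MidChiSq_eq]
  set M : EuclideanSpace ℝ (Fin 3) := (hcpSite a h q - hcpSite a h p) + (1 / 2 : ℝ) • (hcpSite a h (q + s) - hcpSite a h q) with hM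
  have hb := norm_stencil_bond_le ha hh hha q hs
  have hM1 : 27 / 5 * a ≤ ‖M‖ := by
    have h1 : ‖hcpSite a h q - hcpSite a h p‖ ≤ ‖M‖ + ‖(1 / 2 : ℝ) • (hcpSite a h (q + s) - hcpSite a h q)‖ := by
      have := norm_sub_le M ((1 / 2 : ℝ) • (hcpSite a h (q + s) - hcpSite a h q))
      rw [hM, add_sub_cancel_right] at this
      exact this
    rw [norm_smul, Real.norm_eq_abs, abs_of_pos (by norm_num : (0 : ℝ) < 1 / 2)] at h1
    linarith
  have hsq : (27 / 5 * a) ^ 2 ≤ fpSq (fun k => M k) := by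
    rw [fpSq_coe_eq_norm_sq]
    exact pow_le_pow_left₀ (by positivity) hM1 2
  have hS12 : (81 / 20 * a) ^ 2 < (27 / 5 * a) ^ 2 := by nlinarith
  rw [fpChi_eq_one hS12 hsq, one_pow]

/-- **Where the midpoint weight is nonzero the base is at least `1` from `y_p`** (`1 ≤ 2a`). -/
theorem one_le_norm_of_p1MidChiSq_ne_zero {a h : ℝ} (ha : 0 < a) (hh : 0 < h) (hha : h ≤ a) (ha2 : 1 ≤ 2 * a) (p q : ℤ × ℤ × ℤ)
    {s : ℤ × ℤ × ℤ} (hs : s ∈ p1Stencil) (hne : p1MidChiSq a h p q s ≠ 0) : 1 ≤ ‖hcpSite a h q - hcpSite a h p‖ := by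
  by_contra hlt
  rw [not_le] at hlt
  apply hne
  rw [p1MidChiSq_eq]
  set M : EuclideanSpace ℝ (Fin 3) := (hcpSite a h q - hcpSite a h p) + (1 / 2 : ℝ) • (hcpSite a h (q + s) - hcpSite a h q) with hM
  have hb := norm_stencil_bond_le ha hh hha q hs
  have hM1 : ‖M‖ ≤ 1 + a := by
    have h1 := norm_add_le (hcpSite a h q - hcpSite a h p) ((1 / 2 : ℝ) • (hcpSite a h (q + s) - hcpSite a h q))
    rw [norm_smul, Real.norm_eq_abs, abs_of_pos (by norm_num : (0 : ℝ) < 1 / 2)] at h1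
    rw [hM]; linarith
  have hsq : fpSq (fun k => M k) ≤ (81 / 20 * a) ^ 2 := by
    rw [fpSq_coe_eq_norm_sq]
    have h2 : 1 + a ≤ 81 / 20 * a := by linarith
    exact pow_le_pow_left₀ (norm_nonneg _) (hM1.trans h2) 2
  have hS12 : (81 / 20 * a) ^ 2 < (27 / 5 * a) ^ 2 := by nlinarith
  rw [fpChi_eq_zero hS12 hsq]
  ring

/-! ## Nonnegativity -/

/-- **`0 ≤ w`**: the in-layer far shares are nonnegative (β ≥ 0 beyond the well, part 65). -/
theorem p1FarW_nonneg {a h : ℝ} (ha : 0 < a) (hh : 0 < h) (hha : h ≤ a) (ha2 : 1 ≤ 2 * a) (φ : Finset ((ℤ × ℤ × ℤ) × (ℤ × ℤ × ℤ)))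
    (p : ℤ × ℤ × ℤ) (e : (ℤ × ℤ × ℤ) × (ℤ × ℤ × ℤ)) : 0 ≤ p1FarW a h φ p e := by
  unfold p1FarW
  split_ifs with hc
  · by_cases h0 : p1MidChiSq a h p e.1 e.2 = 0
    · rw [h0, mul_zero]
    · have h1 := one_le_norm_of_p1MidChiSq_ne_zero ha hh hha ha2 p e.1 (p1StencilIn_subset hc.2.1) h0
      have hβ := p1Beta_nonneg_of_one_le ha hh p e.1 e.2 h1
      have := p1MidChiSq_nonneg a h p e.1 e.2
      positivity
  · exact le_rfl

/-- **`0 ≤ wv`**: the vertical far shares are nonnegative. -/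
theorem p1FarWv_nonneg {a h : ℝ} (ha : 0 < a) (hh : 0 < h) (hha : h ≤ a) (ha2 : 1 ≤ 2 * a) (φ : Finset ((ℤ × ℤ × ℤ) × (ℤ × ℤ × ℤ)))
    (p q : ℤ × ℤ × ℤ) : 0 ≤ p1FarWv a h φ p q := by
  unfold p1FarWv
  split_ifs with hc
  · by_cases h0 : p1MidChiSq a h p q p1SV = 0
    · rw [h0, mul_zero]
    · have h1 := one_le_norm_of_p1MidChiSq_ne_zero ha hh hha ha2 p q p1SV_mem h0
      have hβ := p1Beta_nonneg_of_one_le ha hh p q p1SV h1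
      have := p1MidChiSq_nonneg a h p q p1SV
      positivity
  · exact le_rfl

/-! ## Summability -/

/-- **The in-layer far loads are summable** (dominated by the readout-form loads of `β`, part 37). -/
theorem summable_p1FarW_load {a h : ℝ} (ha : 0 < a) (hh : 0 < h) (φ : Finset ((ℤ × ℤ × ℤ) × (ℤ × ℤ × ℤ))) (p : ℤ × ℤ × ℤ) :
    Summable fun e : (ℤ × ℤ × ℤ) × (ℤ × ℤ × ℤ) => p1FarW a h φ p e * fpSq (fun k => hcpSite a h (e.1 + e.2) k - hcpSite a h e.1 k) := by
  have hmaj := summable_readoutWeight_of_decay ha hh p1Stencil (p1Beta a h) (p1Beta_decay ha hh) p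
  refine Summable.of_norm_bounded hmaj fun e => ?_
  rw [Real.norm_eq_abs, abs_mul, abs_of_nonneg (fpSq_nonneg _)]
  refine mul_le_mul_of_nonneg_right ?_ (fpSq_nonneg _)
  unfold p1FarW
  by_cases hc : e.1 ≠ p ∧ e.2 ∈ p1StencilIn ∧ (e.1 - p, e.2) ∉ φ
  · rw [if_pos hc, if_pos (p1StencilIn_subset hc.2.1), abs_mul, abs_mul, abs_of_pos (by norm_num : (0 : ℝ) < 1 / 2),
      abs_of_nonneg (p1MidChiSq_nonneg a h p e.1 e.2)]
    have h1 := p1MidChiSq_le_one a h p e.1 e.2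
    have h2 := abs_nonneg (p1Beta a h (decide (Even e.1.1)) (p - e.1) e.2)
    have h3 := p1MidChiSq_nonneg a h p e.1 e.2
    nlinarith
  · rw [if_neg hc, abs_zero]; split_ifs <;> positivity

/-- **The vertical far shares are summable** (decay of `β`). -/
theorem summable_p1FarWv {a h : ℝ} (ha : 0 < a) (hh : 0 < h) (φ : Finset ((ℤ × ℤ × ℤ) × (ℤ × ℤ × ℤ))) (p : ℤ × ℤ × ℤ) :
    Summable (p1FarWv a h φ p) := by
  have hmaj := (summableTransfer_summable_weight ha hh p).mul_left (p1BetaConst a h / 2)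
  refine Summable.of_norm_bounded hmaj fun q => ?_
  rw [Real.norm_eq_abs]
  have hdec := p1Beta_decay ha hh q p p1SV
  rw [norm_sub_rev] at hdec
  unfold p1FarWv
  split_ifs with hc
  · rw [abs_mul, abs_mul, abs_of_pos (by norm_num : (0 : ℝ) < 1 / 2), abs_of_nonneg (p1MidChiSq_nonneg a h p q p1SV)]
    have h1 := p1MidChiSq_le_one a h p q p1SV
    have h2 := abs_nonneg (p1Beta a h (decide (Even q.1)) (p - q) p1SV)
    have h3 : 0 ≤ ((1 + ‖hcpSite a h q - hcpSite a h p‖)⁻¹) ^ 6 := by positivity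
    nlinarith
  · rw [abs_zero]
    exact mul_nonneg (div_nonneg (p1BetaConst_nonneg ha hh) (by norm_num)) (by positivity)

/-! ## Geometry of the box: outside it every site is far from `y_p` -/

/-- **Outside the index box a site is at least `32/5·a` from `y_p`** (`3a/4 ≤ h`; one far coordinate, as in part 63). -/
theorem far_of_not_mem_p1SiteBox {a h : ℝ} (ha : 0 < a) (hlo : 3 / 4 * a ≤ h) (p q : ℤ × ℤ × ℤ) (hq : q ∉ p1SiteBox p) :
    32 / 5 * a ≤ ‖hcpSite a h q - hcpSite a h p‖ := by
  have hh : 0 < h := lt_of_lt_of_le (by positivity) hlo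
  have hout : 15 < |q.1 - p.1| ∨ 20 < |q.2.1 - p.2.1| ∨ 14 < |q.2.2 - p.2.2| := by
    by_contra hc
    simp only [not_or, not_lt] at hc
    obtain ⟨h1, h2, h3⟩ := hc
    apply hq
    simp only [p1SiteBox, Finset.mem_product, Finset.mem_Icc]
    rw [abs_le] at h1 h2 h3
    refine ⟨⟨by linarith [h1.1], by linarith [h1.2]⟩, ⟨by linarith [h2.1], by linarith [h2.2]⟩, ⟨by linarith [h3.1], by linarith [h3.2]⟩⟩
  have hlab : ∀ z : ℤ, (haggLabel alternatingHagg z : ℝ) = 0 ∨ (haggLabel alternatingHagg z : ℝ) = 1 := by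
    intro z
    rcases Int.even_or_odd z with hz | hz
    · left; rw [haggLabel_alternating_of_even hz]; simp
    · right; rw [haggLabel_alternating_of_odd hz]; simp
  have h173 : (173 / 100 : ℝ) ≤ √3 := by
    rw [show (173 / 100 : ℝ) = √((173 / 100) ^ 2) by rw [Real.sqrt_sq (by norm_num)]]
    exact Real.sqrt_le_sqrt (by norm_num)
  -- a far coordinate bounds the Euclidean norm from below
  have hcoord : ∀ j : Fin 3, |hcpSite a h q j - hcpSite a h p j| ≤ ‖hcpSite a h q - hcpSite a h p‖ := by
    intro j
    have := PiLp.norm_apply_le (hcpSite a h q - hcpSite a h p) j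
    rwa [PiLp.sub_apply, Real.norm_eq_abs] at this
  rcases hout with hk | hrest
  · -- third coordinate
    refine le_trans ?_ (hcoord 2)
    rw [hcpSite_apply_two, hcpSite_apply_two]
    have hk' : (16 : ℝ) ≤ |((q.1 : ℝ) - p.1)| := by
      have : (16 : ℤ) ≤ |q.1 - p.1| := hk
      exact_mod_cast this
    rw [show (q.1 : ℝ) * h - (p.1 : ℝ) * h = ((q.1 : ℝ) - p.1) * h by ring, abs_mul, abs_of_pos hh]
    nlinarith
  · by_cases hJ' : 14 < |q.2.2 - p.2.2|
    · -- second coordinate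
      refine le_trans ?_ (hcoord 1)
      rw [hcpSite_apply_one, hcpSite_apply_one]
      have hJr : (15 : ℝ) ≤ |((q.2.2 : ℝ) - p.2.2)| := by
        have : (15 : ℤ) ≤ |q.2.2 - p.2.2| := hJ'
        exact_mod_cast this
      have e : a * √3 / 2 * ((q.2.2 : ℝ) + haggLabel alternatingHagg q.1 / 3) - a * √3 / 2 * ((p.2.2 : ℝ) + haggLabel alternatingHagg p.1 / 3) =
          a * √3 / 2 * (((q.2.2 : ℝ) - p.2.2) + ((haggLabel alternatingHagg q.1 : ℝ) - haggLabel alternatingHagg p.1) / 3) := by ring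
      rw [e, abs_mul, abs_of_pos (by positivity : (0 : ℝ) < a * √3 / 2)]
      have hin : (13 : ℝ) ≤ |((q.2.2 : ℝ) - p.2.2) + ((haggLabel alternatingHagg q.1 : ℝ) - haggLabel alternatingHagg p.1) / 3| := by
        rcases hlab q.1 with l1 | l1 <;> rcases hlab p.1 with l2 | l2 <;>
          rw [l1, l2, le_abs] <;> rcases le_or_gt 0 ((q.2.2 : ℝ) - p.2.2) with hs | hs <;>
          first
          | (left; rw [abs_of_nonneg hs] at hJr; linarith)
          | (right; rw [abs_of_neg hs] at hJr; linarith)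
      have hm := mul_le_mul_of_nonneg_right hin (by positivity : (0 : ℝ) ≤ a * √3 / 2)
      nlinarith [hm, h173, ha]
    · -- first coordinate
      have hJle : |q.2.2 - p.2.2| ≤ 14 := not_lt.1 hJ'
      have hI : 20 < |q.2.1 - p.2.1| := by
        rcases hrest with hI | hJ
        · exact hI
        · exact absurd hJ hJ'
      refine le_trans ?_ (hcoord 0)
      rw [hcpSite_apply_zero, hcpSite_apply_zero]
      have hIr : (21 : ℝ) ≤ |((q.2.1 : ℝ) - p.2.1)| := by
        have : (21 : ℤ) ≤ |q.2.1 - p.2.1| := hI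
        exact_mod_cast this
      have hJr : |((q.2.2 : ℝ) - p.2.2)| ≤ 14 := by exact_mod_cast hJle
      have e : a * ((q.2.1 : ℝ) + (q.2.2 : ℝ) / 2 + haggLabel alternatingHagg q.1 / 2) -
          a * ((p.2.1 : ℝ) + (p.2.2 : ℝ) / 2 + haggLabel alternatingHagg p.1 / 2) =
          a * (((q.2.1 : ℝ) - p.2.1) + ((q.2.2 : ℝ) - p.2.2) / 2 +
            ((haggLabel alternatingHagg q.1 : ℝ) - haggLabel alternatingHagg p.1) / 2) := by ring
      rw [e, abs_mul, abs_of_pos ha]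
      have hin : (13 : ℝ) ≤ |((q.2.1 : ℝ) - p.2.1) + ((q.2.2 : ℝ) - p.2.2) / 2 +
          ((haggLabel alternatingHagg q.1 : ℝ) - haggLabel alternatingHagg p.1) / 2| := by
        rw [abs_le] at hJr
        obtain ⟨hJ1, hJ2⟩ := hJr
        rcases hlab q.1 with l1 | l1 <;> rcases hlab p.1 with l2 | l2 <;>
          rw [l1, l2, le_abs] <;> rcases le_or_gt 0 ((q.2.1 : ℝ) - p.2.1) with hs | hs <;>
          first
          | (left; rw [abs_of_nonneg hs] at hIr; linarith)
          | (right; rw [abs_of_neg hs] at hIr; linarith)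
      have hm := mul_le_mul_of_nonneg_right hin ha.le
      linarith

/-! ## The legs off `p1FarLegs` are fully far -/

/-- **`hwfar`**: off the near legs the far shares take the full readout-form load `½β`. -/
theorem p1Far_hwfar {a h : ℝ} (ha : 0 < a) (hlo : 3 / 4 * a ≤ h) (hha : h ≤ a) (ha2 : 1 ≤ 2 * a)
    (φ : Finset ((ℤ × ℤ × ℤ) × (ℤ × ℤ × ℤ))) (p : ℤ × ℤ × ℤ) (e : (ℤ × ℤ × ℤ) × (ℤ × ℤ × ℤ)) (he : e ∉ p1FarLegs φ p) :
    (if e.1 ≠ p ∧ e.2 ∈ p1Stencil then 1 / 2 * p1Beta a h (decide (Even e.1.1)) (p - e.1) e.2 else 0) ≤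
      p1FarW a h φ p e + (if e.2 = p1SV then p1FarWv a h φ p e.1 else 0) := by
  have hh : 0 < h := lt_of_lt_of_le (by positivity) hlo
  have hW0 := p1FarW_nonneg ha hh hha ha2 φ p e
  have hV0 : 0 ≤ (if e.2 = p1SV then p1FarWv a h φ p e.1 else 0) := by
    split_ifs
    · exact p1FarWv_nonneg ha hh hha ha2 φ p e.1
    · exact le_rfl
  by_cases hc : e.1 ≠ p ∧ e.2 ∈ p1Stencil
  · rw [if_pos hc]
    obtain ⟨hne, hs⟩ := hc
    -- off the legs: the base is outside the box and the leg is not shed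
    have hbox : e.1 ∉ p1SiteBox p := by
      intro hb
      apply he
      exact Finset.mem_union_left _ (Finset.mem_product.2 ⟨hb, hs⟩)
    have hφ : (e.1 - p, e.2) ∉ φ := by
      intro hm
      apply he
      refine Finset.mem_union_right _ (Finset.mem_image.2 ⟨(e.1 - p, e.2), hm, ?_⟩)
      simp only [sub_add_cancel]
    have hfar := far_of_not_mem_p1SiteBox ha hlo p e.1 hbox
    have h1 : p1MidChiSq a h p e.1 e.2 = 1 := p1MidChiSq_eq_one_of_far ha hh hha p e.1 hs hfar
    rcases (mem_p1Stencil_iff e.2).1 hs with hin | hsv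
    · -- in-layer leg: `w = ½β`, no vertical share
      have hnsv : e.2 ≠ p1SV := fun h' => not_mem_p1StencilIn_p1SV (h' ▸ hin)
      rw [if_neg hnsv, add_zero]
      unfold p1FarW
      rw [if_pos ⟨hne, hin, hφ⟩, h1, mul_one]
    · -- the vertical bond: `w = 0`, `wv = ½β`
      rw [if_pos hsv]
      have hw0 : p1FarW a h φ p e = 0 := by
        unfold p1FarW
        rw [if_neg]
        rintro ⟨_, hin, _⟩
        exact not_mem_p1StencilIn_p1SV (hsv ▸ hin)
      rw [hw0, zero_add]
      unfold p1FarWv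
      rw [hsv] at hφ h1
      rw [if_pos ⟨hne, hφ⟩, h1, mul_one, hsv]
  · rw [if_neg hc]
    exact add_nonneg hW0 hV0

end Summit.AtomisticToContinuum.Crystallization.Theorems.StrictSplittingRuleBirth

end
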